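/-
Copyright (c) 2026 the pub-hodgecm-mathlib formalisation cell (harness21).  Prover seat hodgecm-mathlib-K2Liu-p12 (g0): Track B «K2-LIT»,
#184♮ = hLiu418 = stmt-HodgeConjecture-24832; Road Φ of socket #41, organ Φ5 «bad finite places» (LEAD F0P6-plan (g13) ruling «M-157c»: F3c), file F3c-2.
-/
import Summits.HodgeConjecture.HodgeConjecture.Theorems.K2LiuLocalRingValuationBalls   -- ★ F3c-1: balls in `E ⊗ F_v`, `tau_mem_primePowBall`, `ball_of_tau_mem`
import Literature.NumberTheory.Automorphic.TateLocalZetaShells                        -- ★ `primePowBall` algebra (`add_mem`, `neg_mem`, `antitone`), `HasConductorExp`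
import Literature.NumberTheory.Automorphic.UnitaryGroupDoubledBigCellNonsplit           -- ★ `UnitaryGroup.conjLocal_conjLocal` (`σ` is an involution)
import Mathlib.LinearAlgebra.Matrix.Trace
import HarnessLib

/-!
# Crux `HLiu418`, Road Φ of socket #41, organ Φ5 — FILE F3c-2: THE WHITTAKER CHARACTER UNDER THE LEVI MOVES (factorisation, negligibility, boxes, covering)

Cell `hodgecm-mathlib`, crux item hLiu418 = `stmt-HodgeConjecture-24832`, route of record `HCCMUnconditional`; squad K2 ∕ K2Liu, road `K2_Liu`,
socket #41 `sig_K2LiuSiegelEisensteinContinuation`, Road Φ, organ Φ5 (spec `K2/K2Liu-p12/g0/SPEC-PHI5-F3-LeviSupplyAndCovering.K2Liu-p12-g0.md` §F3c).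
THEOREMS ONLY (no `def`, no `instance`, no `notation`, no named-fact hypothesis, no `sorry`); lane `--supports stmt-HodgeConjecture-24832`
(count-neutral helper; closes no socket by itself).  β-DEPENDENT, GROUP-FREE: matrix and valuation algebra over `R = E ⊗ F_v` (★ F3c-1 letter:
`X ∈ ball a` iff `∀ i j w, Valued.v (X i j w) ≤ Valued.v (toPlace v w π) ^ a`, `π` a uniformizer of `F_v`).

THE OBJECTS.  `σ = conjLocal`, `T` a `σ`-fixed symmetric invertible Gram matrix (★ `gramS`), `β` and `t` `T`-SKEW (`σ(X)ᵀ T + T X = 0`: `t` the coordinate of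
`n(t) ∈ N_Δ(F_v)`, `β` the Fourier index), `u` a direction and `u′ := T⁻¹ σ(u)ᵀ T` (so the Levi element `m(1 + ẑu)` of ★ F3a acts by
`t ↦ (1 + ẑu) t (1 + ẑu′)`, `ẑ = ι_v z`), an additive `τ : R → F_v` with `ι_v(τ r) = r + σ r` and `τ(ẑ r) = z τ(r)` (the trace `Tr_{R∕F_v}`, hypothesis-first),
and the LOCAL WHITTAKER CHARACTER in the coordinates, `χ_β(t) = ψ_v(−τ(tr(β t)))` (`= conj ψ_{E,v}(tr(β t))` for `ψ_{E,v} = ψ_v ∘ Tr`).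
* §1 ALGEBRA: `levi_conj_expand` (`(1 + ẑu) t (1 + ẑu′) = t + ẑ(ut + tu′) + ẑ²(u t u′)`); `trace_mul_leviTwist_eq_conj` (for `T`-skew `β, t`:
  `tr(β t u′) = σ(tr(β u t))`), hence `τ(tr(β(ut + tu′))) = 2 τ(tr(β u t))` (`τ ∘ σ = τ`), and `tr(β · single a b ε · t) = ε (tβ)_{ba}`.
* §2 FACTORISATION (F4a `hχL` up to the quadratic factor): `χ_β((1+ẑu)t(1+ẑu′)) = χ_β(t) · ψ_v(z · c_u(t)) · ψ_v(−z² τ(tr(β u t u′)))`,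
  `c_u(t) := −τ(tr(β(ut + tu′)))`.
* §3 SIZES (F4a `hχL`, `hbox`, `hcov`): with `t ∈ ball(−k)`, `u, u′, β ∈ ball(−b)`, `β⁻¹ ∈ ball(−b′)`, `z ∈ 𝔭_v^j`, `0 ≤ b ≤ j`, `k + 4b + d ≤ 2j`:
  NEGLIGIBILITY `z² τ(tr(β u t u′)) ∈ 𝔭_v^d` (so the quadratic factor is `1` for `ψ_v` of conductor exponent `d`); BOXES `c_u(t′) − c_u(t) ∈ 𝔭_v^{d−j}` for
  `t′ = (1+ẑu₁)t(1+ẑu₁′)`; COVERING: if all `c_{E_{ab}}(t)`, `c_{ε E_{ab}}(t)` lie in `𝔭_v^{d−j}` (`ε` integral, `σε = −ε`, `ϖ^{c_ε} ∣ 2ε`, `ϖ^{c₂} ∣ 2`) then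
  `t ∈ ball(d − j − c_ε − c₂ − b′)` (★ F3c-1 `ball_of_tau_mem` on `2(tβ)_{ba}`, then `t = (tβ)β⁻¹`) — so a point of the far shell `t ∉ ball(−k+1)` has SOME
  coefficient outside `𝔭_v^{d−j}` as soon as `j ≤ d + k − 1 − c_ε − c₂ − b′`.  This is `det β ≠ 0` at work (through `β⁻¹`).

## References
* [Casselman1980] W. Casselman, Compositio Math. 40 (1980), §3 (non-degenerate characters: the Jacquet integral over far shells vanishes).
* [KudlaRallis1994] S. Kudla, S. Rallis, Ann. of Math. 140 (1994), §2 (local Whittaker functionals of degenerate principal series; `det β ≠ 0`).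
* [Shimura1997] G. Shimura, *Euler products and Eisenstein series*, CBMS 93 (1997), §18.
* [HarrisKudlaSweet1996] M. Harris, S. Kudla, W. J. Sweet, J. AMS 9 (1996): §1 (1.11)–(1.12) (`Ad(m(a))` on `N_Δ ≅ Herm_n`: `t ↦ a t ᵗā`).
-/

set_option autoImplicit false
-- the mandated namespace repeats the single-problem summit's segment (`HodgeConjecture.HodgeConjecture`)
set_option linter.dupNamespace false

noncomputable section

open scoped Matrix
open NumberField IsDedekindDomain Matrix
open Literature.NumberTheory.Automorphic Literature.NumberTheory.Automorphic.UnitaryGroup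
open Summit.HodgeConjecture.HodgeConjecture.Cruxes.HLiu418.K2LiuLocalRingValuationBalls

namespace Summit.HodgeConjecture.HodgeConjecture.Cruxes.HLiu418.K2LiuWhittakerCharacterMoves

variable (F : Type) [Field F] [NumberField F] (E : Type) [Field E] [NumberField E] [Algebra F E] (c : E ≃ₐ[F] E)
  (v : HeightOneSpectrum (𝓞 F)) {π : v.adicCompletion F} (hπ : Valued.v π = WithZero.exp (-1 : ℤ))
  {m : Type*} [Fintype m] [DecidableEq m]

/-! ## §1 Algebra of the Levi move and of the trace pairing -/

omit [NumberField F] in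
/-- **`(1 + ẑu) t (1 + ẑu′) = t + ẑ(ut + tu′) + ẑ²(u t u′)`** (`ẑ` central). [cite: HarrisKudlaSweet1996, §1 (1.12)] -/
theorem levi_conj_expand (zh : LocalRing E v) (u u' t : Matrix m m (LocalRing E v)) :
    (1 + zh • u) * t * (1 + zh • u') = t + zh • (u * t + t * u') + (zh * zh) • (u * t * u') := by
  simp only [add_mul, mul_add, one_mul, mul_one, smul_mul_assoc, mul_smul_comm, smul_smul, smul_add, Matrix.mul_assoc]
  abel

omit [NumberField F] in
/-- `tr(β · single a b ε · t) = ε · (tβ)_{ba}`. [cite: Casselman1980, §3] -/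
theorem trace_mul_single_mul (β t : Matrix m m (LocalRing E v)) (a b : m) (ε : LocalRing E v) :
    Matrix.trace (β * (Matrix.single a b ε * t)) = ε * (t * β) b a := by
  rw [← Matrix.mul_assoc, Matrix.trace_mul_cycle, Matrix.trace_mul_comm, Matrix.trace_single_mul, smul_eq_mul]

/-- for a `T`-skew `X` (`σ(X)ᵀ T + T X = 0`, `T` symmetric invertible): `σ(X) = −T⁻¹ Xᵀ T`. [cite: HarrisKudlaSweet1996, §1 (1.12)] -/
theorem map_conj_eq_of_skew {T : Matrix m m (LocalRing E v)} (hT : IsUnit T.det) (hTt : Tᵀ = T) {X : Matrix m m (LocalRing E v)}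
    (hX : (X.map (conjLocal E c v))ᵀ * T + T * X = 0) : X.map (conjLocal E c v) = -(T⁻¹ * Xᵀ * T) := by
  have h1 : (X.map (conjLocal E c v))ᵀ = -(T * X * T⁻¹) := by
    have h2 : (X.map (conjLocal E c v))ᵀ * T = -(T * X) := eq_neg_of_add_eq_zero_left hX
    calc (X.map (conjLocal E c v))ᵀ = (X.map (conjLocal E c v))ᵀ * T * T⁻¹ := by rw [Matrix.mul_nonsing_inv_cancel_right _ _ hT]
      _ = -(T * X * T⁻¹) := by rw [h2, Matrix.neg_mul]
  have h3 := congrArg Matrix.transpose h1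
  rw [Matrix.transpose_transpose, Matrix.transpose_neg, Matrix.transpose_mul, Matrix.transpose_mul, Matrix.transpose_nonsing_inv, hTt,
    ← Matrix.mul_assoc] at h3
  exact h3

/-- **the trace pairing under the Levi twist**: for `T`-skew `β, t` and any `u`, `tr(β t u′) = σ(tr(β u t))` with `u′ = T⁻¹σ(u)ᵀT`
(so the two linear terms of `χ_β` along `t ↦ (1+ẑu)t(1+ẑu′)` are `σ`-conjugate). [cite: HarrisKudlaSweet1996, §1 (1.12)] [cite: KudlaRallis1994, §2] -/
theorem trace_mul_leviTwist_eq_conj {T : Matrix m m (LocalRing E v)} (hT : IsUnit T.det) (hTt : Tᵀ = T) {β t : Matrix m m (LocalRing E v)}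
    (hβ : (β.map (conjLocal E c v))ᵀ * T + T * β = 0) (ht : (t.map (conjLocal E c v))ᵀ * T + T * t = 0) (u : Matrix m m (LocalRing E v)) :
    Matrix.trace (β * (t * (T⁻¹ * (u.map (conjLocal E c v))ᵀ * T))) = conjLocal E c v (Matrix.trace (β * (u * t))) := by
  have hσβ := map_conj_eq_of_skew F E c v hT hTt hβ
  have hσt := map_conj_eq_of_skew F E c v hT hTt ht
  -- right-hand side: `σ(tr(βut)) = tr(σβ σu σt) = tr(T⁻¹βᵀT σu T⁻¹tᵀT) = tr(βᵀ T σu T⁻¹ tᵀ)`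
  have hR : conjLocal E c v (Matrix.trace (β * (u * t))) = Matrix.trace (βᵀ * T * (u.map (conjLocal E c v)) * T⁻¹ * tᵀ) := by
    rw [show conjLocal E c v (Matrix.trace (β * (u * t))) = Matrix.trace ((β * (u * t)).map (conjLocal E c v)) from
        AddMonoidHom.map_trace (conjLocal E c v : LocalRing E v →+* LocalRing E v) _,
      Matrix.map_mul, Matrix.map_mul, hσβ, hσt]
    calc Matrix.trace (-(T⁻¹ * βᵀ * T) * (u.map (conjLocal E c v) * -(T⁻¹ * tᵀ * T)))
        = Matrix.trace (T⁻¹ * (βᵀ * T * u.map (conjLocal E c v) * T⁻¹ * tᵀ) * T) := by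
          simp only [Matrix.mul_neg, Matrix.neg_mul, neg_neg, Matrix.mul_assoc]
      _ = Matrix.trace (βᵀ * T * u.map (conjLocal E c v) * T⁻¹ * tᵀ) := by
          rw [Matrix.trace_mul_cycle, Matrix.mul_nonsing_inv _ hT, Matrix.one_mul]
  -- left-hand side: transpose, `tr(Xᵀ) = tr X`
  have hL : Matrix.trace (β * (t * (T⁻¹ * (u.map (conjLocal E c v))ᵀ * T))) = Matrix.trace (T * u.map (conjLocal E c v) * T⁻¹ * tᵀ * βᵀ) := by
    rw [← Matrix.trace_transpose]
    congr 1
    rw [Matrix.transpose_mul, Matrix.transpose_mul, Matrix.transpose_mul, Matrix.transpose_mul, Matrix.transpose_transpose, Matrix.transpose_nonsing_inv,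
      hTt]
    simp only [Matrix.mul_assoc]
  rw [hL, hR, Matrix.trace_mul_comm (T * u.map (conjLocal E c v) * T⁻¹ * tᵀ) βᵀ]
  simp only [Matrix.mul_assoc]

/-- **`τ ∘ σ = τ`** for any `τ` with `ι_v(τ r) = r + σ r` (`σ` is an involution, `ι_v` injective). [cite: CasselsFrohlichANT1967, Ch. VII §1.1] -/
theorem tau_conjLocal [Algebra.IsQuadraticExtension F E] {δ : E} (hcδ : c δ = -δ) (hδ : δ ≠ 0)
    {τ : LocalRing E v → v.adicCompletion F} (hτ : ∀ r, toLocalRing E v (τ r) = r + conjLocal E c v r) (r : LocalRing E v) :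
    τ (conjLocal E c v r) = τ r :=
  toLocalRing_injective E v (by rw [hτ, hτ, UnitaryGroup.conjLocal_conjLocal c v hcδ hδ, add_comm])

/-- **the linear coefficient**: `τ(tr(β(ut + tu′))) = τ(tr(βut)) + τ(tr(βut))` for `T`-skew `β, t`. [cite: KudlaRallis1994, §2] -/
theorem tau_trace_linear_term [Algebra.IsQuadraticExtension F E] {δ : E} (hcδ : c δ = -δ) (hδ : δ ≠ 0)
    {τ : LocalRing E v → v.adicCompletion F} (hτ : ∀ r, toLocalRing E v (τ r) = r + conjLocal E c v r) (hτadd : ∀ r s, τ (r + s) = τ r + τ s)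
    {T : Matrix m m (LocalRing E v)} (hT : IsUnit T.det) (hTt : Tᵀ = T) {β t : Matrix m m (LocalRing E v)}
    (hβ : (β.map (conjLocal E c v))ᵀ * T + T * β = 0) (ht : (t.map (conjLocal E c v))ᵀ * T + T * t = 0) (u : Matrix m m (LocalRing E v)) :
    τ (Matrix.trace (β * (u * t + t * (T⁻¹ * (u.map (conjLocal E c v))ᵀ * T)))) =
      τ (Matrix.trace (β * (u * t))) + τ (Matrix.trace (β * (u * t))) := by
  rw [Matrix.mul_add, Matrix.trace_add, hτadd, trace_mul_leviTwist_eq_conj F E c v hT hTt hβ ht u, tau_conjLocal F E c v hcδ hδ hτ]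

/-! ## §2 Factorisation of the Whittaker character along a Levi move -/

/-- **FACTORISATION**: `χ_β((1+ẑu)t(1+ẑu′)) = χ_β(t) · ψ_v(z · c_u(t)) · ψ_v(−z²·τ(tr(β u t u′)))`, `χ_β(X) = ψ_v(−τ(tr(βX)))`, `c_u(t) = −τ(tr(β(ut + tu′)))`
(`τ` additive and `F_v`-linear). [cite: KudlaRallis1994, §2] [cite: Casselman1980, §3] -/
theorem whittakerChar_levi_conj (ψ : AddChar (v.adicCompletion F) Circle) {τ : LocalRing E v → v.adicCompletion F}
    (hτadd : ∀ r s, τ (r + s) = τ r + τ s) (hτs : ∀ (z : v.adicCompletion F) (r : LocalRing E v), τ (toLocalRing E v z * r) = z * τ r)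
    (β u u' t : Matrix m m (LocalRing E v)) (z : v.adicCompletion F) :
    ((ψ (-τ (Matrix.trace (β * ((1 + toLocalRing E v z • u) * t * (1 + toLocalRing E v z • u'))))) : Circle) : ℂ) =
      ((ψ (-τ (Matrix.trace (β * t))) : Circle) : ℂ) * ((ψ (z * -τ (Matrix.trace (β * (u * t + t * u')))) : Circle) : ℂ) *
        ((ψ (-((z * z) * τ (Matrix.trace (β * (u * t * u'))))) : Circle) : ℂ) := by
  rw [levi_conj_expand, Matrix.mul_add, Matrix.mul_add, Matrix.trace_add, Matrix.trace_add, Matrix.mul_smul, Matrix.mul_smul, Matrix.trace_smul,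
    Matrix.trace_smul, smul_eq_mul, smul_eq_mul, hτadd, hτadd, ← map_mul, hτs, hτs, neg_add, neg_add, AddChar.map_add_eq_mul, AddChar.map_add_eq_mul,
    Circle.coe_mul, Circle.coe_mul, mul_neg z]

/-! ## §3 Sizes: negligibility of the quadratic term, boxes, covering -/

section Sizes

variable {τ : LocalRing E v → v.adicCompletion F}

omit [DecidableEq m] in
include hπ in
/-- sizes of the two terms of the move: `t ∈ ball(−k)`, `u, u′ ∈ ball(−b)` ⇒ `ut + tu′ ∈ ball(−k−b)` … [cite: Casselman1980, §3] -/
theorem mball_linear_term {k b : ℤ} {u u' t : Matrix m m (LocalRing E v)}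
    (hu : ∀ i j (w : PlacesOver E v), Valued.v (u i j w) ≤ Valued.v (toPlace v w π) ^ (-b))
    (hu' : ∀ i j (w : PlacesOver E v), Valued.v (u' i j w) ≤ Valued.v (toPlace v w π) ^ (-b))
    (ht : ∀ i j (w : PlacesOver E v), Valued.v (t i j w) ≤ Valued.v (toPlace v w π) ^ (-k)) :
    ∀ i j (w : PlacesOver E v), Valued.v ((u * t + t * u') i j w) ≤ Valued.v (toPlace v w π) ^ (-k - b) := by
  refine mball_add F E v ?_ ?_
  · have h := mball_mul F E v hπ hu ht
    rw [show -b + -k = -k - b by ring] at h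
    exact h
  · have h := mball_mul F E v hπ ht hu'
    rw [show -k + -b = -k - b by ring] at h
    exact h

omit [DecidableEq m] in
include hπ in
/-- … and `u t u′ ∈ ball(−k−2b)`. [cite: Casselman1980, §3] -/
theorem mball_quadratic_term {k b : ℤ} {u u' t : Matrix m m (LocalRing E v)}
    (hu : ∀ i j (w : PlacesOver E v), Valued.v (u i j w) ≤ Valued.v (toPlace v w π) ^ (-b))
    (hu' : ∀ i j (w : PlacesOver E v), Valued.v (u' i j w) ≤ Valued.v (toPlace v w π) ^ (-b))
    (ht : ∀ i j (w : PlacesOver E v), Valued.v (t i j w) ≤ Valued.v (toPlace v w π) ^ (-k)) :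
    ∀ i j (w : PlacesOver E v), Valued.v ((u * t * u') i j w) ≤ Valued.v (toPlace v w π) ^ (-k - 2 * b) := by
  have h := mball_mul F E v hπ (mball_mul F E v hπ hu ht) hu'
  rw [show -b + -k + -b = -k - 2 * b by ring] at h
  exact h

omit [DecidableEq m] in
include hπ in
/-- the scalar `τ(tr(β X))` of a matrix `X ∈ ball a` lies in `𝔭_v^{a − b}` when `β ∈ ball(−b)`. [cite: Casselman1980, §3] -/
theorem tau_trace_mul_mem (hτ : ∀ r, toLocalRing E v (τ r) = r + conjLocal E c v r) {a b : ℤ} {β X : Matrix m m (LocalRing E v)}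
    (hβ : ∀ i j (w : PlacesOver E v), Valued.v (β i j w) ≤ Valued.v (toPlace v w π) ^ (-b))
    (hX : ∀ i j (w : PlacesOver E v), Valued.v (X i j w) ≤ Valued.v (toPlace v w π) ^ a) :
    τ (Matrix.trace (β * X)) ∈ primePowBall (v.adicCompletion F) (a - b) := by
  refine tau_mem_primePowBall F E c v hπ hτ (ball_trace F E v ?_)
  have h := mball_mul F E v hπ hβ hX
  rw [show -b + a = a - b by ring] at h
  exact h

omit [DecidableEq m] in
include hπ in
/-- **NEGLIGIBILITY of the quadratic term**: for `t ∈ ball(−k)`, `u, u′, β ∈ ball(−b)`, `z ∈ 𝔭_v^j` with `0 ≤ j` and `k + 4b + d ≤ 2j`: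
`z²·τ(tr(β u t u′)) ∈ 𝔭_v^d` — so `ψ_v(−z² τ(tr(β u t u′))) = 1` for `ψ_v` of conductor exponent `d`. [cite: Casselman1980, §3] [cite: Shimura1997, §18] -/
theorem quadratic_term_mem (hτ : ∀ r, toLocalRing E v (τ r) = r + conjLocal E c v r) {k b d j : ℤ} (hb : 0 ≤ b) (h2j : k + 4 * b + d ≤ 2 * j)
    {β u u' t : Matrix m m (LocalRing E v)}
    (hβ : ∀ i j (w : PlacesOver E v), Valued.v (β i j w) ≤ Valued.v (toPlace v w π) ^ (-b))
    (hu : ∀ i j (w : PlacesOver E v), Valued.v (u i j w) ≤ Valued.v (toPlace v w π) ^ (-b))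
    (hu' : ∀ i j (w : PlacesOver E v), Valued.v (u' i j w) ≤ Valued.v (toPlace v w π) ^ (-b))
    (ht : ∀ i j (w : PlacesOver E v), Valued.v (t i j w) ≤ Valued.v (toPlace v w π) ^ (-k))
    {z : v.adicCompletion F} (hz : z ∈ primePowBall (v.adicCompletion F) j) :
    (z * z) * τ (Matrix.trace (β * (u * t * u'))) ∈ primePowBall (v.adicCompletion F) d := by
  have h1 : τ (Matrix.trace (β * (u * t * u'))) ∈ primePowBall (v.adicCompletion F) (-k - 2 * b - b) :=
    tau_trace_mul_mem F E c v hπ hτ hβ (mball_quadratic_term F E v hπ hu hu' ht)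
  have h2 := mul_mem_primePowBall (mul_mem_primePowBall hz hz) h1
  exact primePowBall_antitone (by omega) h2

omit [DecidableEq m] in
include hπ in
/-- with `ψ_v` of conductor exponent `d`, the quadratic factor is `1`. [cite: Casselman1980, §3] -/
theorem addChar_quadratic_term_eq_one {ψ : AddChar (v.adicCompletion F) Circle} {d : ℤ} (hd : ψ.HasConductorExp d)
    (hτ : ∀ r, toLocalRing E v (τ r) = r + conjLocal E c v r) {k b j : ℤ} (hb : 0 ≤ b) (h2j : k + 4 * b + d ≤ 2 * j)
    {β u u' t : Matrix m m (LocalRing E v)}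
    (hβ : ∀ i j (w : PlacesOver E v), Valued.v (β i j w) ≤ Valued.v (toPlace v w π) ^ (-b))
    (hu : ∀ i j (w : PlacesOver E v), Valued.v (u i j w) ≤ Valued.v (toPlace v w π) ^ (-b))
    (hu' : ∀ i j (w : PlacesOver E v), Valued.v (u' i j w) ≤ Valued.v (toPlace v w π) ^ (-b))
    (ht : ∀ i j (w : PlacesOver E v), Valued.v (t i j w) ≤ Valued.v (toPlace v w π) ^ (-k))
    {z : v.adicCompletion F} (hz : z ∈ primePowBall (v.adicCompletion F) j) :
    ((ψ (-((z * z) * τ (Matrix.trace (β * (u * t * u'))))) : Circle) : ℂ) = 1 := by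
  rw [hd.1 _ (neg_mem_primePowBall (quadratic_term_mem F E c v hπ hτ hb h2j hβ hu hu' ht hz)), Circle.coe_one]

include hπ in
/-- **BOXES are permuted**: along a second move `t′ = (1+ẑu₁)t(1+ẑu₁′)` the coefficient `c_u` changes by an element of `𝔭_v^{d−j}`:
`τ(tr(β(u t′ + t′ u′))) − τ(tr(β(u t + t u′))) ∈ 𝔭_v^{d−j}` (`0 ≤ b ≤ j`, `k + 4b + d ≤ 2j`). [cite: Casselman1980, §3] -/
theorem linear_coeff_sub_mem (hτ : ∀ r, toLocalRing E v (τ r) = r + conjLocal E c v r) (hτadd : ∀ r s, τ (r + s) = τ r + τ s)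
    (hτs : ∀ (z : v.adicCompletion F) (r : LocalRing E v), τ (toLocalRing E v z * r) = z * τ r)
    {k b d j : ℤ} (hb : 0 ≤ b) (hbj : b ≤ j) (h2j : k + 4 * b + d ≤ 2 * j) {β u u' u₁ u₁' t : Matrix m m (LocalRing E v)}
    (hβ : ∀ i j (w : PlacesOver E v), Valued.v (β i j w) ≤ Valued.v (toPlace v w π) ^ (-b))
    (hu : ∀ i j (w : PlacesOver E v), Valued.v (u i j w) ≤ Valued.v (toPlace v w π) ^ (-b))
    (hu' : ∀ i j (w : PlacesOver E v), Valued.v (u' i j w) ≤ Valued.v (toPlace v w π) ^ (-b))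
    (hu₁ : ∀ i j (w : PlacesOver E v), Valued.v (u₁ i j w) ≤ Valued.v (toPlace v w π) ^ (-b))
    (hu₁' : ∀ i j (w : PlacesOver E v), Valued.v (u₁' i j w) ≤ Valued.v (toPlace v w π) ^ (-b))
    (ht : ∀ i j (w : PlacesOver E v), Valued.v (t i j w) ≤ Valued.v (toPlace v w π) ^ (-k))
    {z : v.adicCompletion F} (hz : z ∈ primePowBall (v.adicCompletion F) j) :
    τ (Matrix.trace (β * (u * ((1 + toLocalRing E v z • u₁) * t * (1 + toLocalRing E v z • u₁')) +
        (1 + toLocalRing E v z • u₁) * t * (1 + toLocalRing E v z • u₁') * u'))) -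
      τ (Matrix.trace (β * (u * t + t * u'))) ∈ primePowBall (v.adicCompletion F) (d - j) := by
  -- expand the move and collect: the difference is `z·τ(tr(β(uY + Yu′))) + z²·τ(tr(β(uQ + Qu′)))`
  set Y := u₁ * t + t * u₁' with hY
  set Q := u₁ * t * u₁' with hQ
  have hexp : u * ((1 + toLocalRing E v z • u₁) * t * (1 + toLocalRing E v z • u₁')) + (1 + toLocalRing E v z • u₁) * t * (1 + toLocalRing E v z • u₁') * u' =
      (u * t + t * u') + toLocalRing E v z • (u * Y + Y * u') + (toLocalRing E v z * toLocalRing E v z) • (u * Q + Q * u') := by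
    rw [levi_conj_expand, hY, hQ]
    simp only [Matrix.mul_add, Matrix.add_mul, Matrix.mul_smul, Matrix.smul_mul, smul_add]
    abel
  have hdiff : τ (Matrix.trace (β * (u * ((1 + toLocalRing E v z • u₁) * t * (1 + toLocalRing E v z • u₁')) +
        (1 + toLocalRing E v z • u₁) * t * (1 + toLocalRing E v z • u₁') * u'))) - τ (Matrix.trace (β * (u * t + t * u'))) =
      z * τ (Matrix.trace (β * (u * Y + Y * u'))) + (z * z) * τ (Matrix.trace (β * (u * Q + Q * u'))) := by
    rw [hexp, Matrix.mul_add, Matrix.mul_add, Matrix.trace_add, Matrix.trace_add, Matrix.mul_smul, Matrix.mul_smul, Matrix.trace_smul, Matrix.trace_smul,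
      smul_eq_mul, smul_eq_mul, hτadd, hτadd, ← map_mul, hτs, hτs]
    ring
  rw [hdiff]
  have hYb : ∀ i j (w : PlacesOver E v), Valued.v (Y i j w) ≤ Valued.v (toPlace v w π) ^ (-k - b) := mball_linear_term F E v hπ hu₁ hu₁' ht
  have hQb : ∀ i j (w : PlacesOver E v), Valued.v (Q i j w) ≤ Valued.v (toPlace v w π) ^ (-k - 2 * b) := mball_quadratic_term F E v hπ hu₁ hu₁' ht
  have h1 : τ (Matrix.trace (β * (u * Y + Y * u'))) ∈ primePowBall (v.adicCompletion F) (-k - b - b - b) := by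
    refine tau_trace_mul_mem F E c v hπ hτ hβ ?_
    have h := mball_linear_term F E v hπ (k := k + b) hu hu' (by intro i j w; rw [show -(k + b) = -k - b by ring]; exact hYb i j w)
    intro i j w; rw [show -k - b - b = -(k + b) - b by ring]; exact h i j w
  have h2 : τ (Matrix.trace (β * (u * Q + Q * u'))) ∈ primePowBall (v.adicCompletion F) (-k - 2 * b - b - b) := by
    refine tau_trace_mul_mem F E c v hπ hτ hβ ?_
    have h := mball_linear_term F E v hπ (k := k + 2 * b) hu hu' (by intro i j w; rw [show -(k + 2 * b) = -k - 2 * b by ring]; exact hQb i j w)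
    intro i j w; rw [show -k - 2 * b - b = -(k + 2 * b) - b by ring]; exact h i j w
  refine add_mem_primePowBall (primePowBall_antitone (by omega) (mul_mem_primePowBall hz h1))
    (primePowBall_antitone (by omega) (mul_mem_primePowBall (mul_mem_primePowBall hz hz) h2))

include hπ in
/-- division by an element bounded below: `ϖ^{c} ∣ s` (`v_w(ϖ_w)^c ≤ v_w(s_w)`) and `s·r ∈ ball a` ⇒ `r ∈ ball (a − c)`. [cite: CasselsFrohlichANT1967, Ch. II §10] -/
theorem ball_of_ball_mul_left {a cc : ℤ} {s r : LocalRing E v} (hs : ∀ w : PlacesOver E v, Valued.v (toPlace v w π) ^ cc ≤ Valued.v (s w))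
    (hsr : ∀ w : PlacesOver E v, Valued.v ((s * r) w) ≤ Valued.v (toPlace v w π) ^ a) :
    ∀ w : PlacesOver E v, Valued.v (r w) ≤ Valued.v (toPlace v w π) ^ (a - cc) := by
  intro w
  have hne : Valued.v (toPlace v w π) ≠ 0 := valued_toPlace_uniformizer_ne_zero F E v hπ w
  have h : Valued.v (toPlace v w π) ^ cc * Valued.v (r w) ≤ Valued.v (toPlace v w π) ^ a :=
    calc Valued.v (toPlace v w π) ^ cc * Valued.v (r w) ≤ Valued.v (s w) * Valued.v (r w) := mul_le_mul' (hs w) le_rfl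
      _ = Valued.v ((s * r) w) := by rw [Pi.mul_apply, map_mul]
      _ ≤ Valued.v (toPlace v w π) ^ a := hsr w
  rw [zpow_sub₀ hne, le_div_iff₀ (zero_lt_iff.2 (zpow_ne_zero cc hne)), mul_comm]
  exact h

include hπ in
/-- **COVERING (non-degeneracy)**: `β` `T`-skew with `β β⁻ = 1`, `β⁻ ∈ ball(−b′)`; `t` `T`-skew; `ε ∈ R` integral with `σε = −ε`, `ϖ^{c_ε} ∣ 2ε`, `ϖ^{c₂} ∣ 2`.
If EVERY coefficient `τ(tr(β(u t + t u′)))`, `u ∈ {E_{ab}, ε E_{ab}}`, `u′ = T⁻¹σ(u)ᵀT`, lies in `𝔭_v^{μ}`, then `t ∈ ball(μ − c_ε − c₂ − b′)`: the entries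
`(tβ)_{ba}` are recovered from `τ(2(tβ)_{ba})`, `τ(2ε(tβ)_{ba})` (★ F3c-1 `ball_of_tau_mem`) and `t = (tβ)β⁻`.  Contrapositively: a point of the far
shell `t ∉ ball(−k+1)` has some coefficient OUTSIDE `𝔭_v^{μ}` whenever `μ − c_ε − c₂ − b′ ≥ −k + 1`. [cite: KudlaRallis1994, §2] [cite: Casselman1980, §3] -/
theorem mball_of_forall_coeff_mem [Algebra.IsQuadraticExtension F E] {δ : E} (hcδ : c δ = -δ) (hδ : δ ≠ 0)
    (hτ : ∀ r, toLocalRing E v (τ r) = r + conjLocal E c v r) (hτadd : ∀ r s, τ (r + s) = τ r + τ s)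
    {T : Matrix m m (LocalRing E v)} (hT : IsUnit T.det) (hTt : Tᵀ = T)
    {ε : LocalRing E v} (hεσ : conjLocal E c v ε = -ε) (hεint : ∀ w : PlacesOver E v, Valued.v (ε w) ≤ 1)
    {cε c₂ b' μ : ℤ} (hε : ∀ w : PlacesOver E v, Valued.v (toPlace v w π) ^ cε ≤ Valued.v ((2 * ε) w))
    (h2 : ∀ w : PlacesOver E v, Valued.v (toPlace v w π) ^ c₂ ≤ Valued.v ((2 : LocalRing E v) w))
    {β βinv t : Matrix m m (LocalRing E v)} (hββ : β * βinv = 1)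
    (hβinv : ∀ i j (w : PlacesOver E v), Valued.v (βinv i j w) ≤ Valued.v (toPlace v w π) ^ (-b'))
    (hβ : (β.map (conjLocal E c v))ᵀ * T + T * β = 0) (ht : (t.map (conjLocal E c v))ᵀ * T + T * t = 0)
    (hcoef : ∀ a b : m, ∀ e ∈ ({1, ε} : Set (LocalRing E v)),
      τ (Matrix.trace (β * (Matrix.single a b e * t + t * (T⁻¹ * ((Matrix.single a b e).map (conjLocal E c v))ᵀ * T)))) ∈
        primePowBall (v.adicCompletion F) μ) :
    ∀ i j (w : PlacesOver E v), Valued.v (t i j w) ≤ Valued.v (toPlace v w π) ^ (μ - cε - c₂ - b') := by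
  -- every entry `(tβ)_{ba}` lies in `ball (μ − cε − c₂)`
  have hentry : ∀ a b (w : PlacesOver E v), Valued.v ((t * β) b a w) ≤ Valued.v (toPlace v w π) ^ (μ - cε - c₂) := by
    intro a b
    have key : ∀ e : LocalRing E v, τ (Matrix.trace (β * (Matrix.single a b e * t + t * (T⁻¹ * ((Matrix.single a b e).map (conjLocal E c v))ᵀ * T)))) =
        τ (2 * e * (t * β) b a) := fun e => by
      rw [tau_trace_linear_term F E c v hcδ hδ hτ hτadd hT hTt hβ ht, trace_mul_single_mul, ← hτadd]
      congr 1; ring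
    have h1 : τ (2 * (t * β) b a) ∈ primePowBall (v.adicCompletion F) μ := by
      have h := hcoef a b 1 (by simp)
      rwa [key, mul_one] at h
    have h2' : τ (ε * (2 * (t * β) b a)) ∈ primePowBall (v.adicCompletion F) μ := by
      have h := hcoef a b ε (by simp)
      rwa [key, show 2 * ε * (t * β) b a = ε * (2 * (t * β) b a) by ring] at h
    have h3 := ball_of_tau_mem F E c v hπ hτ hεσ hεint hε h1 h2'
    exact ball_of_ball_mul_left F E v hπ h2 h3
  -- `t = (tβ)β⁻`
  have htβ : t = t * β * βinv := by rw [Matrix.mul_assoc, hββ, Matrix.mul_one]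
  have h := mball_mul F E v hπ (a := μ - cε - c₂) (b := -b') (X := t * β) (Y := βinv) (fun i j w => hentry j i w) hβinv
  intro i j w
  rw [htβ, show μ - cε - c₂ - b' = μ - cε - c₂ + -b' by ring]
  exact h i j w

end Sizes

end Summit.HodgeConjecture.HodgeConjecture.Cruxes.HLiu418.K2LiuWhittakerCharacterMoves

end
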